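import Summits.Ventures.HodgeRepro2.T5SU11ResolventComposition
import Summits.Ventures.HodgeRepro2.T5SU11RadialGreenImproperUnique

/-!
# Summary X — the improper Green's operator of the radial Laplacian on decaying sources (rows 492–497), under
uniform names

The headline statements of rows 492–497 about `G^I_λ g = −χ_λ ∫_{(0,t]} φ_λ g sinh 2s − φ_λ ∫_{(t,∞)} χ_λ g sinh 2s`
(`greenSolI`, row 492) for the explicit model, re-exported:

* `greenI_ode` — `G^I_λ g` solves `(L − λ(λ−2)) u = g` on `(0, ∞)` for every source integrable against the basis
  (row 492); `greenI_eq_green` — on compactly supported sources it is row 451's `G_λ` (row 492);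
* `greenI_bounded_origin` — `G^I_λ g` is bounded at the origin for a source bounded on `(0, 1]` (row 493);
* `decay_source_integrable_sph`, `decay_source_integrable_sphDecay` — an exponentially decaying source (rate
  `ε > 2 − λ`) is integrable against the basis (row 496);
* `greenI_decay` — `G^I_λ g / φ_λ → 0` for such a source (row 497), and `greenI_unique` — **`G^I_λ g` is the unique
  bounded `φ_λ`-decaying solution of `(L − μ)v = g`: the resolvent on the exponentially decaying class** (row 497);
* `resolvent_composition` — **`G_λ f − G_{λ₂} f = (μ − μ₂) · G^I_λ(G_{λ₂} f)`**: the composition `G_λ G_{λ₂}` in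
  closed form (row 495).

Nothing is claimed about (N).

Blind lane: Mathlib + the HodgeRepro2 prefix only; no sorry; axioms ⊆ {propext, Classical.choice,
Quot.sound}.
-/

namespace Summit.Ventures.HodgeRepro2.T5SU11RadialSummaryX

open Filter Topology MeasureTheory
open Set (Ioi Ioc)
open T5SU11Cartan T5SU11SphericalFunction T5SU11SphericalSolutionSpaceAll T5SU11SphericalDecay T5SU11SphericalGreen
  T5SU11RadialGreenImproper T5SU11RadialGreenImproperOrigin T5SU11RadialGreenImproperDecaySource
  T5SU11RadialGreenImproperUnique T5SU11ResolventComposition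

section measure

variable [MeasurableSpace Circle] [BorelSpace Circle]

variable {lam : ℝ} (hlam : 1 < lam) {g : ℝ → ℝ} (hg : ContinuousOn g (Ioi 0))
  (hB : ∀ T, IntegrableOn (fun s => sph lam (hyp s) * g s * Real.sinh (2 * s)) (Ioc 0 T))
  (hA : IntegrableOn (fun s => sphDecay lam s * g s * Real.sinh (2 * s)) (Ioi 0))

include hlam in
/-- **`G^I_λ g` solves the inhomogeneous radial equation** for every source integrable against the basis (row 492). -/
theorem greenI_ode {t : ℝ} (ht : 0 < t) :
    Real.sinh (2 * t) * greenSolI'' (deriv (deriv fun t => sph lam (hyp t))) (sphDecay'' lam)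
        (deriv fun t => sph lam (hyp t)) (sphDecay' lam) (fun t => sph lam (hyp t)) (sphDecay lam) g t
      + 2 * Real.cosh (2 * t) * greenSolI' (deriv fun t => sph lam (hyp t)) (sphDecay' lam)
        (fun t => sph lam (hyp t)) (sphDecay lam) g t
      = lam * (lam - 2) * Real.sinh (2 * t) * greenSolI (fun t => sph lam (hyp t)) (sphDecay lam) g t
        + Real.sinh (2 * t) * g t :=
  greenSolI_ode (hode_sph lam) (fun _ hs => sphDecay_ode hlam hs) (fun _ hs => wronskian_sphDecay hlam hs) ht

include hlam hg hB hA in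
/-- **`G^I_λ g` is differentiable with derivative `−χ_λ′ B^I − φ_λ′ A^I`** (row 492). -/
theorem greenI_hasDerivAt {t : ℝ} (ht : 0 < t) :
    HasDerivAt (greenSolI (fun t => sph lam (hyp t)) (sphDecay lam) g)
      (greenSolI' (deriv fun t => sph lam (hyp t)) (sphDecay' lam) (fun t => sph lam (hyp t)) (sphDecay lam) g t) t :=
  hasDerivAt_greenSolI (hφ_sph lam) (fun _ hs => hasDerivAt_sphDecay hlam hs) hg hB hA ht

include hlam hg in
/-- **On compactly supported sources the improper formula is row 451's `G_λ`** (row 492). -/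
theorem greenI_eq_green {a b : ℝ} (ha : 0 < a) (hab : a ≤ b) (hga : ∀ s, s ≤ a → g s = 0)
    (hgb : ∀ s, b ≤ s → g s = 0) {t : ℝ} (ht : 0 < t) :
    greenSolI (fun t => sph lam (hyp t)) (sphDecay lam) g t = sphGreen lam g a b t :=
  greenSolI_eq_greenSol (hφ_sph lam) (fun _ hs => hasDerivAt_sphDecay hlam hs) hg ha hab hga hgb ht

include hlam hA in
/-- **`G^I_λ g` is bounded at the origin** for a source bounded on `(0, 1]` (row 493). -/
theorem greenI_bounded_origin {M : ℝ} (hM : ∀ s ∈ Ioc (0 : ℝ) 1, |g s| ≤ M) (hM0 : 0 ≤ M) :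
    ∃ B : ℝ, ∀ᶠ t in 𝓝[>] (0 : ℝ), |greenSolI (fun t => sph lam (hyp t)) (sphDecay lam) g t| ≤ B :=
  eventually_abs_greenSolI_le hlam hM hM0 hA

variable {M : ℝ} (hM : ∀ s ∈ Ioc (0 : ℝ) 1, |g s| ≤ M) (hM0 : 0 ≤ M)
  {ε C s₀ : ℝ} (hε : 2 - lam < ε) (hC : ∀ s, s₀ ≤ s → |g s| ≤ C * Real.exp (-ε * s))

include hg hM hM0 in
/-- **An exponentially decaying source is integrable against `φ_λ`** on every `(0, T]` (row 496). -/
theorem decay_source_integrable_sph (T : ℝ) :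
    IntegrableOn (fun s => sph lam (hyp s) * g s * Real.sinh (2 * s)) (Ioc 0 T) :=
  integrableOn_sph_mul_mul_sinh_Ioc hg hM hM0 lam T

include hlam hg hM hM0 hε hC in
/-- **An exponentially decaying source is integrable against `χ_λ`** on `(0, ∞)` (row 496). -/
theorem decay_source_integrable_sphDecay :
    IntegrableOn (fun s => sphDecay lam s * g s * Real.sinh (2 * s)) (Ioi 0) :=
  integrableOn_sphDecay_mul_mul_sinh hlam hg hM hM0 hε hC

include hlam hg hM hM0 hε hC in
/-- **`G^I_λ g / φ_λ → 0`** for an exponentially decaying source (row 497). -/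
theorem greenI_decay :
    Tendsto (fun t => greenSolI (fun t => sph lam (hyp t)) (sphDecay lam) g t / sph lam (hyp t)) atTop (𝓝 0) :=
  tendsto_greenSolI_div_atTop hlam hg hM hM0 hε hC

include hlam hg hM hM0 hε hC in
/-- **`G^I_λ g` is the unique bounded `φ_λ`-decaying solution of `(L − μ)v = g`** (row 497). -/
theorem greenI_unique {v v' v'' : ℝ → ℝ}
    (hv : ∀ t, 0 < t → HasDerivAt v (v' t) t) (hv' : ∀ t, 0 < t → HasDerivAt v' (v'' t) t)
    (hvode : ∀ t, 0 < t → Real.sinh (2 * t) * v'' t + 2 * Real.cosh (2 * t) * v' t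
      = lam * (lam - 2) * Real.sinh (2 * t) * v t + Real.sinh (2 * t) * g t)
    {B : ℝ} (hB : ∀ᶠ t in 𝓝[>] (0 : ℝ), |v t| ≤ B)
    (hdecay : Tendsto (fun t => v t / sph lam (hyp t)) atTop (𝓝 0)) {t : ℝ} (ht : 0 < t) :
    v t = greenSolI (fun t => sph lam (hyp t)) (sphDecay lam) g t :=
  eq_greenSolI_of_ode hlam hg hM hM0 hε hC hv hv' hvode hB hdecay ht

/-- **The composition `G_λ G_{λ₂}` in closed form** (row 495): `G_λ f − G_{λ₂} f = (μ − μ₂) G^I_λ(G_{λ₂} f)`. -/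
theorem resolvent_composition {lam lam₂ a b : ℝ} {f : ℝ → ℝ} (hlam : 1 < lam) (hlam₂ : 1 < lam₂)
    (hf : ContinuousOn f (Ioi 0)) (ha : 0 < a) (hab : a ≤ b) (hfa : ∀ s, s ≤ a → f s = 0)
    (hfb : ∀ s, b ≤ s → f s = 0) {t : ℝ} (ht : 0 < t) :
    sphGreen lam f a b t - sphGreen lam₂ f a b t
      = (lam * (lam - 2) - lam₂ * (lam₂ - 2))
        * greenSolI (fun t => sph lam (hyp t)) (sphDecay lam) (sphGreen lam₂ f a b) t :=
  sphGreen_sub_sphGreen_eq hlam hlam₂ hf ha hab hfa hfb ht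

end measure

end Summit.Ventures.HodgeRepro2.T5SU11RadialSummaryX
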